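import Literature.AlgebraicGeometry.AbelianSchemes.PolarizationOntoGeometricPoints
import Literature.AlgebraicGeometry.ModuliOfAbelianVarieties.SiegelFineModuliScheme
import HarnessLib

/-!
# Every triple classified by a Siegel fine moduli scheme has a `g`-dimensional dual with `λ̄_s` an isogeny onto, and carries the
# level-`n` structure `(σᵢ^d ≫ λ)ᵢ` on its dual — for ANY locally noetherian `ℚ`-scheme as base

Layer `Literature/AlgebraicGeometry/ModuliOfAbelianVarieties`, namespace
`Literature.AlgebraicGeometry.ModuliOfAbelianVarieties.SiegelFineModuliScheme`.  THEOREMS ONLY (no definition, no named fact, no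
instance, no `sorry`).

[MumfordFogartyKirwan1994, Ch. 7 §3 Thm. 7.9 / Def. 7.2]: a fine moduli scheme `𝓜 = 𝒜_{g,δ,N} ⊗ ℚ` (★ `SiegelFineModuliScheme`)
classifies every polarised abelian scheme with level structure `P′` over a locally noetherian `ℚ`-scheme `T` as a PULL-BACK of the
universal triple (★ `exists_isBaseChangeVia_classifyingMap`).  Hence fibrewise invariants of the universal dual transport to
`P′` along the cartesian square `Ĝ` (★ (D1) `dim_fibre_eq_of_isBaseChangeVia`): with `𝓜.M → Spec ℚ` locally of finite type
([Lan2013] 1.4.1.11: quasi-projective) the universal dual has `g`-dimensional fibres (★ (D1)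
`Polarization.dim_hat_fibre_eq_of_locallyOfFiniteType`, `ℚ` countable), so

* `dim_hat_fibre_eq_of_classify` — `dim Â′_t = g` at EVERY field-valued point of ANY locally noetherian `ℚ`-scheme `T`;
* `isIsogeny_fibreHom_lam_of_classify` / **`exists_comp_lam_eq_of_classify`** — `λ̄′_t` is an isogeny and ONTO on geometric
  points (★ (ISO-pts) `Polarization.isIsogeny_fibreHom_lam` / `exists_comp_lam_eq_of_dim_hat`; [MumfordAV1970] §8 Thm. 1);
* **`exists_hatLevelStructure_of_classify`** — the level-`n` structure `(σᵢ^d ≫ λ′)ᵢ` on `Â′` for `N = n·d`, `(∏ δᵢ, n) = 1`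
  (★ (D2) `exists_hatLevelStructure_of_dim_hat`; `n` is invertible on the `ℚ`-scheme `T`, ★ `natCast_residueField_ne_zero_of_charZero`);
  `torsionSurj_lam_of_classify` — the `n`-torsion form.

These are the (u5)/(K)/(h1) inputs of the Hecke-link line for triples `P′` over a thick piece `S″` that are related to the universal
family only through ★ `classify` (no `P.baseChange` spelling needed).  Cell `hodgecm-mathlib` (D-0151), socket (B) adapter (O2)
(B-p02 (g11)); count-neutral.  HC_CM is proved only modulo the 7 printed citations until rung 0 closes.

## References
* [MumfordFogartyKirwan1994] D. Mumford, J. Fogarty, F. Kirwan, *GIT* 3rd ed. (1994), Ch. 7 §2 Def. 7.1–7.2 (p. 129), §3 Thm. 7.9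
  (p. 139), App. 7A (pp. 234–235).
* [MumfordAV1970] D. Mumford, *Abelian Varieties* (1970), §7 Thm. 4 (p. 72), §8 Thm. 1 (p. 77), §13 Cor. 3 (p. 130).
* [Lan2013PELCompactifications] K.-W. Lan, *Arithmetic compactifications of PEL-type Shimura varieties* (2013), Thm. 1.4.1.11 (p. 91).
-/

noncomputable section

open CategoryTheory CategoryTheory.Limits AlgebraicGeometry Cardinal

namespace Literature.AlgebraicGeometry.ModuliOfAbelianVarieties

namespace SiegelFineModuliScheme

open Literature.AlgebraicGeometry.AbelianSchemes Literature.AlgebraicGeometry.AbelianSchemes.AbelianSchemeOver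
  Literature.AlgebraicGeometry.Motives
open scoped MonObj

variable {g N : ℕ} {δ : Fin g → ℕ} (𝓜 : SiegelFineModuliScheme g N δ) [LocallyOfFiniteType 𝓜.M.hom]
  {T : SchemeOver ℚ} [IsLocallyNoetherian T.left] (P' : PolarizedAbelianSchemeWithLevel g N δ T.left)

include 𝓜

/-- **`dim Â′_t = g` for every triple classified by `𝓜`**, at every field-valued point `t` of its (locally noetherian) `ℚ`-base:
`P′` is a pull-back of the universal triple (★ `exists_isBaseChangeVia_classifyingMap`), fibre dimensions transport along the
cartesian square `Ĝ` (★ `dim_fibre_eq_of_isBaseChangeVia`), and the universal dual has `g`-dimensional fibres (★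
`Polarization.dim_hat_fibre_eq_of_locallyOfFiniteType` over `𝓜.M → Spec ℚ`).
[cite: MumfordFogartyKirwan1994, Ch. 7 §3 Theorem 7.9 (p. 139) and §2 Definition 7.2 (p. 129)] [cite: MumfordAV1970, §13 Cor. 3 (p. 130)] -/
theorem dim_hat_fibre_eq_of_classify {Ω : Type} [Field Ω] (t : Spec (.of Ω) ⟶ T.left) :
    (P'.D.hat.fibre t).toAbelianVariety.dim = g := by
  obtain ⟨G, Ĝ, h⟩ := 𝓜.exists_isBaseChangeVia_classifyingMap T P'
  rw [dim_fibre_eq_of_isBaseChangeVia h.2.1 t]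
  exact 𝓜.univ.pol.dim_hat_fibre_eq_of_locallyOfFiniteType 𝓜.univ.relDim (F := ℚ) Cardinal.mk_le_aleph0 𝓜.M.hom _

/-- **`λ̄′_t` is an isogeny** at every geometric point of any triple classified by `𝓜` (finite kernel of type `δ` + equal
dimensions, ★ `Polarization.isIsogeny_fibreHom_lam`). [cite: MumfordAV1970, §7 Thm. 4 (p. 72) and §8 Thm. 1 (p. 77)]
[cite: MumfordFogartyKirwan1994, App. 7A (pp. 234–235)] -/
theorem isIsogeny_fibreHom_lam_of_classify ⦃Ω : Type⦄ [Field Ω] [IsAlgClosed Ω] (t : Spec (.of Ω) ⟶ T.left) :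
    haveI := P'.pol.isMonHom
    AbelianVariety.IsIsogeny (fibreHom P'.pol.lam t) := by
  haveI := P'.pol.isMonHom
  exact P'.pol.isIsogeny_fibreHom_lam P'.hasType t
    ((dim_fibre_of_isOfRelDim P'.relDim t).trans (𝓜.dim_hat_fibre_eq_of_classify P' t).symm)

/-- **`λ̄′_t` is ONTO on geometric points** for every triple classified by `𝓜` — the `hsurj` binder of ★
`exists_hatLevelStructure` / the `hsurj_s` input of the symmetric-witness construction, for ANY locally noetherian `ℚ`-base.
[cite: MumfordAV1970, §8 Thm. 1 (p. 77)] [cite: MumfordFogartyKirwan1994, Ch. 7 §3 Theorem 7.9 (p. 139)] -/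
theorem exists_comp_lam_eq_of_classify ⦃Ω : Type⦄ [Field Ω] [IsAlgClosed Ω] (t : Spec (.of Ω) ⟶ T.left)
    (y : P'.D.hat.FibrePoints t) : ∃ x : P'.A.FibrePoints t, x ≫ P'.pol.lam = y := by
  haveI := P'.pol.isMonHom
  exact P'.pol.exists_comp_lam_eq_of_dim_hat P'.hasType t
    ((dim_fibre_of_isOfRelDim P'.relDim t).trans (𝓜.dim_hat_fibre_eq_of_classify P' t).symm) y

/-- **`λ̄′` is onto the `n`-torsion** (the `hsurjn` form) for every triple classified by `𝓜`, `(∏ δᵢ, n) = 1`, `n ≠ 0`.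
[cite: MumfordAV1970, §7 Thm. 4 (p. 72)] [cite: MumfordFogartyKirwan1994, App. 7A (pp. 234–235)] -/
theorem torsionSurj_lam_of_classify {n : ℕ} (hn : n ≠ 0) (hcop : Nat.Coprime (∏ i, δ i) n)
    ⦃Ω : Type⦄ [Field Ω] [IsAlgClosed Ω] (t : Spec (.of Ω) ⟶ T.left) (y : P'.D.hat.FibrePoints t) (hy : y ^ n = 1) :
    ∃ x : P'.A.FibrePoints t, x ^ n = 1 ∧ x ≫ P'.pol.lam = y :=
  P'.torsionSurj_lam_of_dim_hat hcop
    (fun x => PolarizedAbelianSchemeWithLevel.natCast_residueField_ne_zero_of_charZero T.hom x hn)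
    (fun _ _ _ t' => 𝓜.dim_hat_fibre_eq_of_classify P' t') t y hy

/-- **The level-`n` structure `(σᵢ^d ≫ λ′)ᵢ` on the dual `Â′` of EVERY triple classified by `𝓜`** over any locally noetherian
`ℚ`-scheme, `N = n·d`, `(∏ δᵢ, n) = 1` — ★ (D2) `exists_hatLevelStructure_of_dim_hat` with both binders discharged («`Â′[n]` is
CONSTANT, `= λ′(A′[n])`»; the `φ : LevelStructure g n Â′` input of (K)).
[cite: MumfordFogartyKirwan1994, Ch. 7 §2 Definition 7.1 (p. 129), §3 Theorem 7.9 (p. 139) and App. 7A (pp. 234–235)]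
[cite: MumfordAV1970, §7 Thm. 4 (p. 72)] -/
theorem exists_hatLevelStructure_of_classify {n d : ℕ} (hd : N = n * d) (hN : N ≠ 0) (hcop : Nat.Coprime (∏ i, δ i) n) :
    ∃ χ : P'.D.hat.LevelStructure g n, ∀ i, χ.σ i = (P'.level.changeLevel n d hd hN).σ i ≫ P'.pol.lam := by
  have hn0 : n ≠ 0 := by
    rintro rfl
    exact hN (by rw [hd, zero_mul])
  exact P'.exists_hatLevelStructure_of_dim_hat hd hN hcop
    (fun x => PolarizedAbelianSchemeWithLevel.natCast_residueField_ne_zero_of_charZero T.hom x hn0)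
    (fun _ _ _ t => 𝓜.dim_hat_fibre_eq_of_classify P' t)

end SiegelFineModuliScheme

end Literature.AlgebraicGeometry.ModuliOfAbelianVarieties
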